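import Summits.AtomisticToContinuum.BoseEinsteinCondensation.Theorems.BECCutLineWeakDisorderGroundStateRigidityStubChainedTube
import HarnessLib

/-!
# Crux `GroundStateRigidity` (stmt-AtomisticToContinuum-9072), line `Sketch`:
# the registered stub `stub_posOfConnected`

Supports (does not close) stmt-AtomisticToContinuum-9072; stub `stub_posOfConnected` of line
`Sketch` (Stub 19). **A.e. positivity of nonnegative closed-form ground states on a chain-connected
carrier in the free region (hard-core class).** Given the chained tube bound (the statement of the
neighbouring stub `stub_chainedTube`, a hypothesis here), `N ≥ 1`, `L > 0`, a measurable pair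
profile `v` with `v ≤ C` beyond `b > 0`, energy truncation `supₙ E₀(v ⊓ n) = E₀(v)`, and a
measurable carrier `S` inside the free region `{all pairs > b} ∩ Λ^N` whose points are pairwise
joined by clearance chains through the box and off which every ground state vanishes a.e.: every
nonnegative ground state `Ψ₀` of `v` is a.e. `> 0` on `S`.

## Proof

With `Tₙ = e^{-H(v ⊓ n)}` on `L²(Λ)` (`fkL2`), `‖Tₙ‖ = e^{-E₀(v⊓n)}` (Perron–Frobenius vector and
`norm_fkL2_one_eq_exp_neg_groundStateEnergy`) and the closed-form Jensen inequality
`stub_closedJensen` give `‖TₙΨ₀ − λΨ₀‖² ≤ e^{-2E₀(v⊓n)} − λ² → 0`, `λ = e^{-E₀(v)}`, hence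
`‖Tₙ^k Ψ₀ − λ^k Ψ₀‖ ≤ k ‖TₙΨ₀ − λΨ₀‖ → 0` (`‖Tₙ‖ ≤ 1`, telescoping). If `A = S ∩ {Ψ₀ ≤ 0}` had
positive measure: `P = S ∩ {Ψ₀ > 0}` has positive measure too (else `Ψ₀ = 0` a.e.), and by the
Lindelöf property (`exists_mem_forall_mem_nhdsWithin_pos_measure`) there are `X⋆ ∈ A` all of whose
coordinate boxes charge `A` and `Y⋆ ∈ P` all of whose coordinate boxes charge `P`. A clearance chain
from `Y⋆` to `X⋆` has length `k ≥ 1` (`Y⋆ ≠ X⋆`), and the chained tube bound with `w = v ⊓ n`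
(`≤ C` beyond `b` for every `n`) gives `(e^{-H(v⊓n)})^k 1_A ≥ c > 0` on a fixed coordinate box `B`
around `Y⋆`, for all `n`; so `Iₙ = ∫_Λ Ψ₀ · Tₙ^k 1_A ≥ c ∫_{B ∩ Λ} Ψ₀ > 0`, while by symmetry of
`Tₙ^k` and `Ψ₀ = 0` on `A`, `Iₙ = ⟪Tₙ^k Ψ₀ − λ^k Ψ₀, 1_A⟫ → 0` — a contradiction.
Reed–Simon IV §XIII.12 Thm XIII.44 (positivity improving semigroups and ground states).
-/

noncomputable section

open MeasureTheory Filter Set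
open scoped ENNReal NNReal Topology InnerProductSpace

namespace Summit.AtomisticToContinuum.BoseEinsteinCondensation.Theorems.GroundStateRigidity

open Literature.MathematicalPhysics.QuantumManyBody.BoseGas

namespace PosOfConnected

open ChainedTube

variable {N : ℕ}

/-! ### Iterates of the semigroup -/

/-- **Iterated approximate eigenvector estimate.** For a bounded operator `T` with `‖T‖ ≤ 1`,
`0 ≤ λ ≤ 1` and any vector `ψ`: `‖T^k ψ − λ^k ψ‖ ≤ k ‖Tψ − λψ‖`
(`T^{k+1}ψ − λ^{k+1}ψ = T(T^kψ − λ^kψ) + λ^k(Tψ − λψ)`). [folklore] -/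
theorem norm_pow_apply_sub_pow_smul_le {H : Type*} [NormedAddCommGroup H] [NormedSpace ℝ H]
    (T : H →L[ℝ] H) (hT : ‖T‖ ≤ 1) {lam : ℝ} (h0 : 0 ≤ lam) (h1 : lam ≤ 1) (ψ : H) (k : ℕ) :
    ‖(T ^ k) ψ - lam ^ k • ψ‖ ≤ k * ‖T ψ - lam • ψ‖ := by
  induction k with
  | zero => simp
  | succ k ih =>
    have heq : (T ^ (k + 1)) ψ - lam ^ (k + 1) • ψ =
        T ((T ^ k) ψ - lam ^ k • ψ) + lam ^ k • (T ψ - lam • ψ) := by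
      rw [pow_succ', mul_apply_eq_comp, map_sub, map_smul, smul_sub, smul_smul,
        ← pow_succ]
      abel
    rw [heq, Nat.cast_succ, add_mul, one_mul]
    refine (norm_add_le _ _).trans (add_le_add ?_ ?_)
    · calc ‖T ((T ^ k) ψ - lam ^ k • ψ)‖ ≤ ‖T‖ * ‖(T ^ k) ψ - lam ^ k • ψ‖ := T.le_opNorm _
        _ ≤ 1 * ((k : ℝ) * ‖T ψ - lam • ψ‖) := mul_le_mul hT ih (norm_nonneg _) zero_le_one
        _ = (k : ℝ) * ‖T ψ - lam • ψ‖ := one_mul _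
    · rw [norm_smul, norm_pow, Real.norm_eq_abs, abs_of_nonneg h0]
      calc lam ^ k * ‖T ψ - lam • ψ‖ ≤ 1 * ‖T ψ - lam • ψ‖ :=
            mul_le_mul_of_nonneg_right (pow_le_one₀ h0 h1) (norm_nonneg _)
        _ = ‖T ψ - lam • ψ‖ := one_mul _

/-- **Powers of `e^{-H}` on `L²(Λ)` act by iterates of `fkReal`**: if the class `fL` is represented
by `f` a.e. on the box, then `(fkL2 w L 1)^k fL` is represented by `(fkReal w L 1)^[k] f` a.e. on
the box (`fkL2_coeFn` and insensitivity of `fkReal` to null modifications on the box). [folklore] -/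
theorem coeFn_pow_fkL2 {w : ℝ → ℝ≥0∞} (hw : Measurable w) (L : ℝ) {f : Config N → ℝ}
    {fL : Lp ℝ 2 (volume.restrict (boxN N L))}
    (hf : (fL : Config N → ℝ) =ᵐ[volume.restrict (boxN N L)] f) (k : ℕ) :
    (((fkL2 w L 1) ^ k) fL : Config N → ℝ) =ᵐ[volume.restrict (boxN N L)]
      (fkReal w L 1)^[k] f := by
  induction k with
  | zero => simpa using hf
  | succ k ih =>
    rw [pow_succ', mul_apply_eq_comp, Function.iterate_succ']
    filter_upwards [fkL2_coeFn hw L one_pos (((fkL2 w L 1) ^ k) fL)] with X hX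
    rw [hX, Function.comp_apply, fkReal_congr_ae_restrict w L one_pos ih X]

/-- Iterates of `e^{-tH}` do not increase the `L²(Λ)` mass (`t ≥ 0`). [folklore] -/
theorem setLIntegral_iterate_fkReal_sq_le {w : ℝ → ℝ≥0∞} (hw : Measurable w) (L : ℝ) {t : ℝ}
    (ht : 0 ≤ t) {f : Config N → ℝ} (hf : Measurable f) (k : ℕ) :
    ∫⁻ Y in boxN N L, ‖((fkReal w L t)^[k] f) Y‖ₑ ^ (2 : ℝ) ≤
      ∫⁻ Y in boxN N L, ‖f Y‖ₑ ^ (2 : ℝ) := by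
  induction k with
  | zero => exact le_rfl
  | succ k ih =>
    simp only [Function.iterate_succ_apply']
    exact (setLIntegral_enorm_fkReal_sq_le hw L ht (measurable_iterate_fkReal hw L t hf k)).trans ih

/-- Iterates of `e^{-H}` of a measurable observable square integrable on the box are in `L²(Λ)`.
[folklore] -/
theorem memLp_iterate_fkReal {w : ℝ → ℝ≥0∞} (hw : Measurable w) (L : ℝ) {f : Config N → ℝ}
    (hf : Measurable f) (hf2 : ∫⁻ Y in boxN N L, ‖f Y‖ₑ ^ (2 : ℝ) ≠ ⊤) (k : ℕ) :
    MemLp ((fkReal w L 1)^[k] f) 2 (volume.restrict (boxN N L)) := by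
  refine ⟨(measurable_iterate_fkReal hw L 1 hf k).aestronglyMeasurable, ?_⟩
  rw [eLpNorm_two_eq]
  exact ENNReal.rpow_lt_top_of_nonneg (by norm_num)
    (ne_top_of_le_ne_top hf2 (setLIntegral_iterate_fkReal_sq_le hw L zero_le_one hf k))

end PosOfConnected

/-! ### The stub -/

set_option maxHeartbeats 400000 in
open PosOfTrunc ChainedTube PosOfConnected in
/-- **Stub `stub_posOfConnected` of line `Sketch` (Stub 19) — a.e. positivity of nonnegative ground
states on a chain-connected carrier in the free region (hard-core class)** (statement and proof in
the module docstring: approximate Perron–Frobenius vector by Jensen +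
`‖e^{-H(v⊓n)}‖ = e^{-E₀(v⊓n)}`, its `k`-fold iterate, symmetry of `(e^{-H(v⊓n)})^k`, and the
`n`-uniform chained tube bound along a clearance chain from a charged point of `S ∩ {Ψ₀ > 0}` to a
charged point of `S ∩ {Ψ₀ ≤ 0}`).
[cite: ReedSimonIV1978, §XIII.12 Thm XIII.44] -/
theorem stub_posOfConnected :
    (∀ (N : ℕ) (L b : ℝ), 0 < L → 0 ≤ b →
      ∀ (k : ℕ) (Z : ℕ → Config N) (m : ℝ), 0 < k → 0 < m → (∀ l : ℕ, l ≤ k → Z l ∈ boxN N L) →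
      (∀ l : ℕ, l < k → ∀ θ : ℝ, θ ∈ Set.Icc (0 : ℝ) 1 → ∀ i j : Fin N, i ≠ j →
        b + 2 * m ≤ ‖(1 - θ) • (Z l i - Z l j) + θ • (Z (l + 1) i - Z (l + 1) j)‖) →
      ∀ A : Set (Config N), MeasurableSet A →
      (∀ δ : ℝ, 0 < δ → 0 < volume (A ∩ {W : Config N | ∀ i c, |W i c - Z k i c| < δ})) →
      ∀ C : ℝ≥0, ∃ c : ℝ, 0 < c ∧ ∃ δ₀ : ℝ, 0 < δ₀ ∧ ∀ w : ℝ → ℝ≥0∞, Measurable w →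
        (∀ s : ℝ, b + m ≤ s → w s ≤ C) →
        ∀ Y' : Config N, (∀ i c, |Y' i c - Z 0 i c| ≤ δ₀) →
          c ≤ ((fkReal w L 1)^[k]) (A.indicator fun _ => (1 : ℝ)) Y') →
    ∀ (N : ℕ) (v : ℝ → ℝ≥0∞) (L b : ℝ) (C : ℝ≥0), 1 ≤ N → 0 < L → 0 < b → Measurable v →
      (∀ s : ℝ, s ∈ Set.Icc 0 b → v s = ⊤) → (∀ s : ℝ, b < s → v s ≤ C) →
      (⨆ n : ℕ, groundStateEnergy (fun r => min (v r) (n : ℝ≥0∞)) N L = groundStateEnergy v N L) →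
      ∀ S : Set (Config N), MeasurableSet S →
      S ⊆ {Z : Config N | Z ∈ boxN N L ∧ ∀ i j : Fin N, i ≠ j → b < dist (Z i) (Z j)} →
      (∀ X ∈ S, ∀ Y ∈ S, ∃ (k : ℕ) (Z : ℕ → Config N) (m : ℝ), Z 0 = X ∧ Z k = Y ∧ 0 < m ∧
        (∀ l : ℕ, l ≤ k → Z l ∈ boxN N L) ∧
        ∀ l : ℕ, l < k → ∀ θ : ℝ, θ ∈ Set.Icc (0 : ℝ) 1 → ∀ i j : Fin N, i ≠ j →
          b + 2 * m ≤ ‖(1 - θ) • (Z l i - Z l j) + θ • (Z (l + 1) i - Z (l + 1) j)‖) →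
      (∀ Ψ : Config N → ℂ, IsGroundState v L Ψ → ∀ᵐ X : Config N, X ∉ S → Ψ X = 0) →
      ∀ Ψ₀ : Config N → ℝ, (∀ X, 0 ≤ Ψ₀ X) → IsGroundState v L (fun X => (Ψ₀ X : ℂ)) →
        ∀ᵐ X : Config N, X ∈ S → 0 < Ψ₀ X := by
  intro hT N v L b C hN hL hb hv _hcore hvC hsup S hSm hSfree hconn hvan Ψ₀ hΨ0 hΨ
  -- the truncated profiles `w n = v ⊓ n`
  set w : ℕ → ℝ → ℝ≥0∞ := fun n r => min (v r) (n : ℝ≥0∞) with hwdef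
  have hwm : ∀ n, Measurable (w n) := fun n => hv.min measurable_const
  have hwC : ∀ n : ℕ, ∀ r, w n r ≤ ((n : ℝ≥0) : ℝ≥0∞) := fun n r => by
    rw [ENNReal.coe_natCast]; exact min_le_right _ _
  have hwv : ∀ n, ∀ r, w n r ≤ v r := fun n r => min_le_left _ _
  have hwb : ∀ n, ∀ m : ℝ, 0 < m → ∀ s : ℝ, b + m ≤ s → w n s ≤ C := fun n m hm s hs =>
    (hwv n s).trans (hvC s (by linarith))
  -- Step A: energies and the eigenvalue `lam = e^{-E₀}`
  set E : ℝ≥0∞ := groundStateEnergy v N L with hEdef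
  have hE : E ≠ ⊤ := hΨ.groundStateEnergy_ne_top
  set En : ℕ → ℝ≥0∞ := fun n => groundStateEnergy (w n) N L with hEndef
  have hmonoE : ∀ {u u' : ℝ → ℝ≥0∞}, (∀ r, u r ≤ u' r) →
      groundStateEnergy u N L ≤ groundStateEnergy u' N L := fun h =>
    iInf_mono fun Ψ => lintegral_mono fun X =>
      add_le_add le_rfl (mul_le_mul' (ClosedJensen.interaction_mono h X) le_rfl)
  have hEn_mono : Monotone En := by
    refine monotone_nat_of_le_succ fun n => hmonoE fun r => ?_
    exact min_le_min le_rfl (by exact_mod_cast Nat.le_succ n)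
  have hEn_tend : Tendsto (fun n => (En n).toReal) atTop (𝓝 E.toReal) := by
    have h1 : Tendsto En atTop (𝓝 (⨆ n, En n)) := tendsto_atTop_iSup hEn_mono
    rw [show (⨆ n, En n) = E from hsup] at h1
    exact (ENNReal.tendsto_toReal hE).comp h1
  set lam : ℝ := Real.exp (-E.toReal) with hlamdef
  have hlam0 : 0 < lam := Real.exp_pos _
  have hlam1 : lam ≤ 1 := Real.exp_le_one_iff.2 (neg_nonpos.2 ENNReal.toReal_nonneg)
  -- `Ψ₀`: measurable, zero off the box, normalised, in `L²(Λ)`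
  have hΨm : Measurable Ψ₀ := by
    have h := Complex.measurable_re.comp hΨ.measurable
    have heq : (Complex.re ∘ fun X => (Ψ₀ X : ℂ)) = Ψ₀ := funext fun X => Complex.ofReal_re _
    rwa [heq] at h
  have hΨz : ∀ X, X ∉ boxN N L → Ψ₀ X = 0 := fun X hX =>
    Complex.ofReal_eq_zero.1 (hΨ.eq_zero X hX)
  have hΨ1 : ∫⁻ X, ‖Ψ₀ X‖ₑ ^ 2 = 1 := by
    refine Eq.trans (lintegral_congr fun X => ?_) hΨ.norm_eq
    rw [enorm_eq_nnnorm, Complex.nnnorm_real]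
  have hΨsq : ∫ X, Ψ₀ X ^ 2 = 1 := by
    rw [integral_eq_lintegral_of_nonneg_ae (Eventually.of_forall fun X => sq_nonneg _)
      (hΨm.pow_const 2).aestronglyMeasurable]
    simp_rw [← enorm_sq_eq_ofReal_sq]
    rw [hΨ1, ENNReal.toReal_one]
  have hΨmem : MemLp Ψ₀ 2 (volume.restrict (boxN N L)) := by
    refine MemLp.restrict _ ⟨hΨm.aestronglyMeasurable, ?_⟩
    rw [eLpNorm_eq_lintegral_rpow_enorm_toReal two_ne_zero ENNReal.ofNat_ne_top,
      ENNReal.toReal_ofNat]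
    simp_rw [ENNReal.rpow_two]
    rw [hΨ1, ENNReal.one_rpow]
    exact ENNReal.one_lt_top
  set! ψL : Lp ℝ 2 (volume.restrict (boxN N L)) := hΨmem.toLp Ψ₀ with hψLdef
  have hψL1 : ‖ψL‖ = 1 := by
    have h : ‖ψL‖ ^ 2 = 1 := by
      rw [hψLdef, ClosedJensen.norm_toLp_sq, setIntegral_eq_integral_of_forall_compl_eq_zero
        (fun X hX => by simp [hΨz X hX]), hΨsq]
    nlinarith [norm_nonneg ψL]
  -- Step B: the approximate eigenvector estimate and its `k`-fold iterate
  have hA : ∀ n : ℕ, ‖fkL2 (w n) L 1 ψL - lam • ψL‖ ^ 2 ≤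
      Real.exp (-(En n).toReal) ^ 2 - lam ^ 2 := by
    intro n
    obtain ⟨-, e, -, -, hTe, hepos, -⟩ := fkL2_perronFrobenius (N := N) (hwm n) (hwC n) hL one_pos
    have hnorm : ‖fkL2 (N := N) (w n) L 1‖ = Real.exp (-(En n).toReal) :=
      norm_fkL2_one_eq_exp_neg_groundStateEnergy hN (hwm n) (hwC n) hL hTe hepos
    have hRay : lam ≤ ⟪ψL, fkL2 (w n) L 1 ψL⟫_ℝ := by
      rw [hψLdef, ClosedJensen.inner_toLp_fkL2_toLp (hwm n) L one_pos hΨmem]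
      exact stub_closedJensen N v (w n) (n : ℝ≥0) L hN hL hv (hwm n) (hwC n) (hwv n) Ψ₀ hΨ0 hΨ
    exact norm_sub_smul_sq_le (fkL2 (w n) L 1) hψL1 hlam0.le hRay hnorm.le
  have hA_tend : Tendsto (fun n : ℕ => Real.exp (-(En n).toReal) ^ 2 - lam ^ 2) atTop (𝓝 0) := by
    have h : Tendsto (fun n : ℕ => Real.exp (-(En n).toReal) ^ 2 - lam ^ 2) atTop
        (𝓝 (Real.exp (-E.toReal) ^ 2 - lam ^ 2)) :=
      ((Real.continuous_exp.tendsto _).comp hEn_tend.neg).pow 2 |>.sub tendsto_const_nhds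
    rwa [hlamdef, sub_self] at h
  have hAk : ∀ (k : ℕ) (n : ℕ), ‖((fkL2 (w n) L 1) ^ k) ψL - lam ^ k • ψL‖ ≤
      k * Real.sqrt (Real.exp (-(En n).toReal) ^ 2 - lam ^ 2) := by
    intro k n
    refine (norm_pow_apply_sub_pow_smul_le _ (norm_fkL2_le_one _ _ _) hlam0.le hlam1 ψL k).trans
      (mul_le_mul_of_nonneg_left ?_ (Nat.cast_nonneg _))
    rw [← Real.sqrt_sq (norm_nonneg (fkL2 (w n) L 1 ψL - lam • ψL))]
    exact Real.sqrt_le_sqrt (hA n)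
  -- suppose the zero set `A` of `Ψ₀` in `S` has positive measure
  rw [ae_iff]
  by_contra hAne
  set! A : Set (Config N) := {X | X ∈ S ∧ Ψ₀ X ≤ 0} with hAdef
  have hAeq : {X : Config N | ¬(X ∈ S → 0 < Ψ₀ X)} = A := by
    ext X; simp [hAdef, not_lt]
  rw [hAeq] at hAne
  have hAm : MeasurableSet A := hSm.inter (measurableSet_le hΨm measurable_const)
  have hΨA : ∀ X ∈ A, Ψ₀ X = 0 := fun X hX => le_antisymm hX.2 (hΨ0 X)
  -- the positivity set `P` of `Ψ₀` in `S` has positive measure too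
  set! P : Set (Config N) := {X | X ∈ S ∧ 0 < Ψ₀ X} with hPdef
  have hPne : volume P ≠ 0 := by
    intro hP0
    have h1 : ∀ᵐ X : Config N, X ∉ P := measure_eq_zero_iff_ae_notMem.1 hP0
    have h2 : ∀ᵐ X : Config N, X ∉ S → (Ψ₀ X : ℂ) = 0 := hvan _ hΨ
    have hzero : ∀ᵐ X : Config N, Ψ₀ X = 0 := by
      filter_upwards [h1, h2] with X hXP hXS
      by_cases hXmem : X ∈ S
      · exact le_antisymm (not_lt.1 fun hpos => hXP ⟨hXmem, hpos⟩) (hΨ0 X)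
      · exact Complex.ofReal_eq_zero.1 (hXS hXmem)
    have hint0 : ∫⁻ X, ‖Ψ₀ X‖ₑ ^ 2 = 0 := by
      refine (lintegral_eq_zero_iff' (hΨm.enorm.pow_const 2).aemeasurable).2 ?_
      filter_upwards [hzero] with Y hY
      simp [hY]
    rw [hint0] at hΨ1
    exact zero_ne_one hΨ1
  -- Lindelöf: points of `A` and `P` charged in every coordinate box
  have hcharge : ∀ {D : Set (Config N)} {Xc : Config N}, (∀ t ∈ 𝓝[D] Xc, 0 < volume t) →
      ∀ δ : ℝ, 0 < δ → 0 < volume (D ∩ {W : Config N | ∀ i c, |W i c - Xc i c| < δ}) :=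
    fun {D Xc} hch δ hδ =>
      hch _ (inter_mem_nhdsWithin _ ((isOpen_coordBox Xc δ).mem_nhds (by simp [hδ])))
  obtain ⟨Xs, hXs, hXcharge⟩ := exists_mem_forall_mem_nhdsWithin_pos_measure hAne
  obtain ⟨Ys, hYs, hYcharge⟩ := exists_mem_forall_mem_nhdsWithin_pos_measure hPne
  -- a clearance chain from `Ys` to `Xs`, of length `k ≥ 1` since `Ys ≠ Xs`
  obtain ⟨k, Z, m, hZ0, hZk, hm, hZbox, hclear⟩ := hconn Ys hYs.1 Xs hXs.1
  have hk : 0 < k := by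
    refine Nat.pos_of_ne_zero fun hk0 => ?_
    have hYX : Ys = Xs := by rw [← hZ0, ← hZk, hk0]
    have hpos : 0 < Ψ₀ Xs := hYX ▸ hYs.2
    exact absurd hpos (not_lt.2 hXs.2)
  -- the chained tube bound, uniform in `n`
  have hAcharge : ∀ δ : ℝ, 0 < δ →
      0 < volume (A ∩ {W : Config N | ∀ i c, |W i c - Z k i c| < δ}) := by
    rw [hZk]; exact hcharge hXcharge
  obtain ⟨c, hc, δ₀, hδ₀, H⟩ := hT N L b hL hb.le k Z m hk hm hZbox hclear A hAm hAcharge C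
  set! g : Config N → ℝ := A.indicator fun _ => (1 : ℝ) with hgdef
  have hcn : ∀ (n : ℕ) (Y' : Config N), (∀ i c, |Y' i c - Ys i c| ≤ δ₀) →
      c ≤ ((fkReal (w n) L 1)^[k]) g Y' := fun n Y' hY' =>
    H (w n) (hwm n) (hwb n m hm) Y' (by rw [hZ0]; exact hY')
  -- `g = 1_A` and its iterates
  have hgm : Measurable g := measurable_const.indicator hAm
  have hg0 : ∀ X, 0 ≤ g X := fun X => Set.indicator_nonneg (fun _ _ => zero_le_one) X
  have hg1 : ∀ X, g X ≤ 1 := fun X => Set.indicator_le_self' (fun _ _ => zero_le_one) X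
  have hgabs : ∀ X, ‖g X‖ ≤ 1 := fun X => by
    rw [Real.norm_eq_abs, abs_of_nonneg (hg0 X)]; exact hg1 X
  haveI : IsFiniteMeasure (volume.restrict (boxN N L)) :=
    isFiniteMeasure_restrict.2 (volume_boxN_lt_top N L).ne
  have hgmem : MemLp g 2 (volume.restrict (boxN N L)) :=
    MemLp.of_bound hgm.aestronglyMeasurable 1 (Eventually.of_forall hgabs)
  have hg2 : ∫⁻ Y in boxN N L, ‖g Y‖ₑ ^ (2 : ℝ) ≠ ⊤ := by
    refine ne_top_of_le_ne_top (volume_boxN_lt_top N L).ne ?_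
    calc ∫⁻ Y in boxN N L, ‖g Y‖ₑ ^ (2 : ℝ) ≤ ∫⁻ _Y in boxN N L, 1 := by
          refine lintegral_mono fun Y => ?_
          rw [ENNReal.rpow_two, Real.enorm_of_nonneg (hg0 Y)]
          exact pow_le_one' (ENNReal.ofReal_le_one.2 (hg1 Y)) 2
      _ = volume (boxN N L) := by rw [setLIntegral_const, one_mul]
  set! gL : Lp ℝ 2 (volume.restrict (boxN N L)) := hgmem.toLp g with hgLdef
  have hF0 : ∀ (n : ℕ) (Y : Config N), 0 ≤ ((fkReal (w n) L 1)^[k]) g Y := fun n =>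
    iterate_fkReal_nonneg (w n) L 1 hg0 k
  have hFmem : ∀ n : ℕ, MemLp ((fkReal (w n) L 1)^[k] g) 2 (volume.restrict (boxN N L)) :=
    fun n => memLp_iterate_fkReal (hwm n) L hgm hg2 k
  -- the pairings `Iₙ = ∫_Λ Ψ₀ · Tₙ^k 1_A`
  set! I : ℕ → ℝ := fun n => ∫ X in boxN N L, Ψ₀ X * ((fkReal (w n) L 1)^[k]) g X with hIdef
  -- upper bound: `Iₙ = ⟪Tₙ^k ψ − λ^k ψ, 1_A⟫ → 0`
  have hI_inner : ∀ n, I n = ⟪((fkL2 (w n) L 1) ^ k) ψL - lam ^ k • ψL, gL⟫_ℝ := by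
    intro n
    have h1 : ⟪ψL, ((fkL2 (w n) L 1) ^ k) gL⟫_ℝ =
        ∫ X in boxN N L, Ψ₀ X * ((fkReal (w n) L 1)^[k]) g X := by
      rw [L2.inner_def, hgLdef, hψLdef]
      refine integral_congr_ae ?_
      filter_upwards [hΨmem.coeFn_toLp, coeFn_pow_fkL2 (hwm n) L hgmem.coeFn_toLp k]
        with X hX1 hX2
      rw [Real.inner_apply, hX2, hX1]
    have h2 : ⟪ψL, gL⟫_ℝ = 0 := by
      rw [L2.inner_def]
      refine integral_eq_zero_of_ae ?_
      filter_upwards [hgmem.coeFn_toLp, hΨmem.coeFn_toLp] with X h1' h2'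
      rw [RCLike.inner_apply, conj_trivial, hgLdef, h1', hψLdef, h2', Pi.zero_apply]
      by_cases hX : X ∈ A
      · rw [hΨA X hX, mul_zero]
      · rw [hgdef, Set.indicator_of_notMem hX, zero_mul]
    have h3 : ⟪((fkL2 (w n) L 1) ^ k) ψL, gL⟫_ℝ = ⟪ψL, ((fkL2 (w n) L 1) ^ k) gL⟫_ℝ :=
      ((isSelfAdjoint_fkL2 (hwm n) L one_pos).pow k).isSymmetric ψL gL
    have h4 : ⟪lam ^ k • ψL, gL⟫_ℝ = 0 := by rw [real_inner_smul_left, h2, mul_zero]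
    calc I n = ⟪ψL, ((fkL2 (w n) L 1) ^ k) gL⟫_ℝ := h1.symm
      _ = ⟪((fkL2 (w n) L 1) ^ k) ψL, gL⟫_ℝ := h3.symm
      _ = ⟪((fkL2 (w n) L 1) ^ k) ψL, gL⟫_ℝ - ⟪lam ^ k • ψL, gL⟫_ℝ := (sub_eq_self.2 h4).symm
      _ = ⟪((fkL2 (w n) L 1) ^ k) ψL - lam ^ k • ψL, gL⟫_ℝ := (inner_sub_left _ _ _).symm
  have hI_tend : Tendsto I atTop (𝓝 0) := by
    have hb : ∀ n, |I n| ≤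
        ‖gL‖ * ((k : ℝ) * Real.sqrt (Real.exp (-(En n).toReal) ^ 2 - lam ^ 2)) := by
      intro n
      rw [hI_inner n]
      calc |⟪((fkL2 (w n) L 1) ^ k) ψL - lam ^ k • ψL, gL⟫_ℝ|
          ≤ ‖((fkL2 (w n) L 1) ^ k) ψL - lam ^ k • ψL‖ * ‖gL‖ := abs_real_inner_le_norm _ _
        _ ≤ ((k : ℝ) * Real.sqrt (Real.exp (-(En n).toReal) ^ 2 - lam ^ 2)) * ‖gL‖ :=
          mul_le_mul_of_nonneg_right (hAk k n) (norm_nonneg _)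
        _ = ‖gL‖ * ((k : ℝ) * Real.sqrt (Real.exp (-(En n).toReal) ^ 2 - lam ^ 2)) :=
          mul_comm _ _
    have h0 : Tendsto (fun n => ‖gL‖ * ((k : ℝ) *
        Real.sqrt (Real.exp (-(En n).toReal) ^ 2 - lam ^ 2))) atTop (𝓝 0) := by
      have h := (Real.continuous_sqrt.tendsto _).comp hA_tend
      rw [Function.comp_def, Real.sqrt_zero] at h
      simpa using (h.const_mul (k : ℝ)).const_mul ‖gL‖
    exact squeeze_zero_norm (fun n => by rw [Real.norm_eq_abs]; exact hb n) h0
  -- lower bound: `Iₙ ≥ c ∫_{B ∩ Λ} Ψ₀ > 0` on the coordinate box `B` around `Ys`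
  set! B : Set (Config N) := {W | ∀ i c, |W i c - Ys i c| < δ₀} with hBdef
  have hBm : MeasurableSet B := (isOpen_coordBox Ys δ₀).measurableSet
  have hΨint : Integrable Ψ₀ (volume.restrict (boxN N L)) := MemLp.integrable one_le_two hΨmem
  have hJpos : 0 < ∫ X in B ∩ boxN N L, Ψ₀ X := by
    rw [setIntegral_pos_iff_support_of_nonneg_ae (Eventually.of_forall fun X => hΨ0 X)
      (IntegrableOn.mono_set (hΨint : IntegrableOn Ψ₀ (boxN N L) volume) inter_subset_right)]
    refine (hcharge hYcharge δ₀ hδ₀).trans_le (measure_mono fun X hX => ?_)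
    exact ⟨hX.1.2.ne', hX.2, (hSfree hX.1.1).1⟩
  have hI_low : ∀ n, c * (∫ X in B ∩ boxN N L, Ψ₀ X) ≤ I n := by
    intro n
    have h1 : c * (∫ X in B ∩ boxN N L, Ψ₀ X) =
        ∫ X in boxN N L, B.indicator (fun X => c * Ψ₀ X) X := by
      rw [integral_indicator hBm, Measure.restrict_restrict hBm, integral_const_mul]
    rw [h1, hIdef]
    refine integral_mono ((hΨint.const_mul c).indicator hBm) (hΨmem.integrable_mul (hFmem n))
      fun X => ?_
    by_cases hXB : X ∈ B
    · rw [Set.indicator_of_mem hXB]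
      calc c * Ψ₀ X = Ψ₀ X * c := mul_comm _ _
        _ ≤ Ψ₀ X * ((fkReal (w n) L 1)^[k]) g X :=
          mul_le_mul_of_nonneg_left (hcn n X fun i c => (hXB i c).le) (hΨ0 X)
    · rw [Set.indicator_of_notMem hXB]
      exact mul_nonneg (hΨ0 X) (hF0 n X)
  -- contradiction
  have hle : c * (∫ X in B ∩ boxN N L, Ψ₀ X) ≤ 0 := ge_of_tendsto' hI_tend hI_low
  exact absurd hle (not_le.2 (mul_pos hc hJpos))

end Summit.AtomisticToContinuum.BoseEinsteinCondensation.Theorems.GroundStateRigidity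

end
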